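import Mathlib

/-!
# Route PhotonSphereChannels — channel energies of the far `t`-polynomial kernel elements vanish

Helper file for the FAR half of `FixedModeChannels` (stmt-FinalStateConjecture-10048), companion of
`PhotonSphereChannelsFarKernel.lean` but logically independent of it (Mathlib only): for ANY
`t`-polynomial `p(t,x) = Σ_{m ≤ N/2} C_m(x) t^{N−2m}` (`N ≤ ℓ`) whose coefficients obey the size
bounds `|C_m| ≤ K₂ y^{2m−ℓ}`, `|C_m'| ≤ K₂ y^{2m−ℓ−1}` in `y = x − x₀ > X ≥ 1`, and any potential with
`0 ≤ V ≤ B/y²` there, the energy density `e = p_t² + p_x² + V p²` of the route's items satisfies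

  `e(t,x) ≤ C_e · y^{2(N−ℓ)−2}`  on every channel region `{x > R + |t|}`, `R ≥ x₀ + X`

(`|t| ≤ y` there), hence the channel energies `∫_{x > R+|t|} e(t,x) dx` are finite and tend to `0`
as `t → ±∞` (`farKernel_channelEnergy`): the `t`-polynomial kernel elements of
`farKernel_tPolynomial` radiate nothing through the far channel, in the item's `lintegral`/`liminf`
vocabulary.
-/

noncomputable section

namespace Summit.FinalStateConjecture.FinalStateConjecture.Theorems

open MeasureTheory Set Filter Topology Real Finset

/-! ### A translated power tail -/

/-- `∫_{(c,∞)} (x − x₀)^q dx = (c − x₀)^{q+1}/(−q−1)` and integrability, for `q < −1`, `x₀ < c`. -/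
theorem integral_Ioi_rpow_sub_const {q x₀ c : ℝ} (hq : q < -1) (hc : x₀ < c) :
    IntegrableOn (fun x : ℝ => (x - x₀) ^ q) (Ioi c)
      ∧ ∫ x in Ioi c, (x - x₀) ^ q = (c - x₀) ^ (q + 1) / (-q - 1) := by
  have hq1 : q + 1 ≠ 0 := by linarith
  have hderiv : ∀ x ∈ Ici c, HasDerivAt (fun x : ℝ => (x - x₀) ^ (q + 1) / (q + 1)) ((x - x₀) ^ q) x := by
    intro x hx
    have hx0 : x - x₀ ≠ 0 := by have : c ≤ x := hx; linarith
    have h := ((Real.hasDerivAt_rpow_const (p := q + 1) (Or.inl hx0)).comp x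
      ((hasDerivAt_id x).sub_const x₀)).div_const (q + 1)
    refine h.congr_deriv ?_
    rw [show q + 1 - 1 = q by ring]
    field_simp
  have htend : Tendsto (fun x : ℝ => (x - x₀) ^ (q + 1) / (q + 1)) atTop (𝓝 0) := by
    have h1 : Tendsto (fun x : ℝ => x - x₀) atTop atTop := tendsto_atTop_add_const_right _ _ tendsto_id
    have h2 : Tendsto (fun y : ℝ => y ^ (q + 1)) atTop (𝓝 0) := by
      have := tendsto_rpow_neg_atTop (y := -(q + 1)) (by linarith)
      simpa using this
    simpa using (h2.comp h1).div_const (q + 1)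
  have hpos : ∀ x ∈ Ioi c, 0 ≤ (x - x₀) ^ q := fun x hx =>
    (Real.rpow_pos_of_pos (by have : c < x := hx; linarith) q).le
  refine ⟨integrableOn_Ioi_deriv_of_nonneg' hderiv hpos htend, ?_⟩
  rw [integral_Ioi_of_hasDerivAt_of_tendsto' hderiv (integrableOn_Ioi_deriv_of_nonneg' hderiv hpos htend)
    htend, show -q - 1 = -(q + 1) by ring, div_neg]
  ring

/-! ### Channel energies of `t`-polynomials with power-bounded coefficients -/

/-- **Channel energies of the far `t`-polynomial kernel elements vanish.** See the module docstring.
Hypotheses: `N ≤ ℓ`, `X ≥ 1`, `p = Σ_{m ≤ N/2} C_m t^{N−2m}`, `C_m` differentiable on `(x₀+X, ∞)`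
with `|C_m| ≤ K₂ y^{2m−ℓ}`, `|C_m'| ≤ K₂ y^{2m−ℓ−1}` (`y = x − x₀`), `V ≤ B/y²` there.
Conclusions, with `e = p_t² + p_x² + Vp²` (the items' density) and any `R ≥ x₀ + X`:
the pointwise bound on `{x > R + |t|}`, the decay of `∫⁻_{x > R+|t|} e` as `t → ±∞`, and its
finiteness. -/
theorem farKernel_channelEnergy {p : ℝ → ℝ → ℝ} {C : ℕ → ℝ → ℝ} {V : ℝ → ℝ}
    {x₀ X K₂ B : ℝ} {N ℓ : ℕ} (hN : N ≤ ℓ) (hX : 1 ≤ X)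
    (hp : ∀ t x, p t x = ∑ m ∈ Finset.range (N / 2 + 1), C m x * t ^ (N - 2 * m))
    (hCd : ∀ m, 2 * m ≤ N → DifferentiableOn ℝ (C m) (Ioi (x₀ + X)))
    (hCb : ∀ m, 2 * m ≤ N → ∀ x, x₀ + X < x → |C m x| ≤ K₂ * (x - x₀) ^ (2 * (m : ℝ) - ℓ))
    (hC'b : ∀ m, 2 * m ≤ N → ∀ x, x₀ + X < x →
      |deriv (C m) x| ≤ K₂ * (x - x₀) ^ (2 * (m : ℝ) - ℓ - 1))
    (hVB : ∀ x, x₀ + X < x → V x ≤ B / (x - x₀) ^ 2) (hB : 0 ≤ B) :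
    (∀ R, x₀ + X ≤ R → ∀ t x, R + |t| < x →
        deriv (fun τ => p τ x) t ^ 2 + deriv (p t) x ^ 2 + V x * p t x ^ 2
          ≤ ((N / 2 + 1 : ℕ) * K₂) ^ 2 * ((N : ℝ) ^ 2 + 1 + B) * (x - x₀) ^ (2 * ((N : ℝ) - ℓ) - 2))
    ∧ (∀ R, x₀ + X ≤ R → Tendsto (fun t => ∫⁻ x in Ioi (R + |t|),
        ENNReal.ofReal (deriv (fun τ => p τ x) t ^ 2 + deriv (p t) x ^ 2 + V x * p t x ^ 2)) atTop (𝓝 0))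
    ∧ (∀ R, x₀ + X ≤ R → Tendsto (fun t => ∫⁻ x in Ioi (R + |t|),
        ENNReal.ofReal (deriv (fun τ => p τ x) t ^ 2 + deriv (p t) x ^ 2 + V x * p t x ^ 2)) atBot (𝓝 0))
    ∧ (∀ R, x₀ + X ≤ R → ∀ t, (∫⁻ x in Ioi (R + |t|),
        ENNReal.ofReal (deriv (fun τ => p τ x) t ^ 2 + deriv (p t) x ^ 2 + V x * p t x ^ 2)) < ⊤) := by
  set H : ℕ := N / 2 with hH
  set S : ℝ := ((N / 2 + 1 : ℕ) : ℝ) * K₂ with hS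
  set a : ℝ := (N : ℝ) - ℓ with ha
  have hNl : (N : ℝ) ≤ ℓ := by exact_mod_cast hN
  have ha0 : a ≤ 0 := by rw [ha]; linarith
  have hmem : ∀ {m}, m ∈ Finset.range (H + 1) → 2 * m ≤ N := fun {m} hm => by
    have := Finset.mem_range.1 hm; omega
  -- `K₂ ≥ 0` (from the bound at one point) unless the range is trivial; we derive it when needed
  -- (1) pointwise bounds on a channel region
  have key : ∀ t x, x₀ + X < x → |t| ≤ x - x₀ →
      |p t x| ≤ S * (x - x₀) ^ a
      ∧ |deriv (fun τ => p τ x) t| ≤ (N : ℝ) * S * (x - x₀) ^ (a - 1)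
      ∧ |deriv (p t) x| ≤ S * (x - x₀) ^ (a - 1) := by
    intro t x hx hty
    set y : ℝ := x - x₀ with hy
    have hy1 : 1 ≤ y := by rw [hy]; linarith
    have hy0 : 0 < y := lt_of_lt_of_le one_pos hy1
    have hK₂ : 0 ≤ K₂ := by
      have h := hCb 0 (by omega) x hx
      have hpos : 0 < (x - x₀) ^ (2 * ((0 : ℕ) : ℝ) - ℓ) := Real.rpow_pos_of_pos hy0 _
      rcases le_or_gt 0 K₂ with h' | h'
      · exact h'
      · linarith [abs_nonneg (C 0 x), mul_neg_of_neg_of_pos h' hpos]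
    -- `|t|^k ≤ y^k` and the exponent bookkeeping
    have htk : ∀ k : ℕ, |t| ^ k ≤ y ^ (k : ℝ) := fun k => by
      rw [Real.rpow_natCast]; exact pow_le_pow_left₀ (abs_nonneg t) hty k
    have hcast : ∀ {m}, 2 * m ≤ N → ((N - 2 * m : ℕ) : ℝ) = (N : ℝ) - 2 * m := fun {m} hm => by
      rw [Nat.cast_sub hm]; push_cast; ring
    -- term bounds
    have hterm : ∀ m ∈ Finset.range (H + 1), |C m x * t ^ (N - 2 * m)| ≤ K₂ * y ^ a := by
      intro m hm
      have hm2 := hmem hm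
      rw [abs_mul, abs_pow]
      calc |C m x| * |t| ^ (N - 2 * m) ≤ K₂ * y ^ (2 * (m : ℝ) - ℓ) * y ^ ((N - 2 * m : ℕ) : ℝ) :=
            mul_le_mul (hCb m hm2 x hx) (htk _) (pow_nonneg (abs_nonneg t) _) (by positivity)
        _ = K₂ * y ^ a := by
            rw [mul_assoc, ← Real.rpow_add hy0, hcast hm2, ha]; ring_nf
    have hterm_t : ∀ m ∈ Finset.range (H + 1),
        |C m x * (((N - 2 * m : ℕ) : ℝ) * t ^ (N - 2 * m - 1))| ≤ (N : ℝ) * K₂ * y ^ (a - 1) := by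
      intro m hm
      have hm2 := hmem hm
      rcases Nat.eq_zero_or_pos (N - 2 * m) with h0 | hpos
      · rw [h0]; simp; positivity
      · have hcast1 : ((N - 2 * m - 1 : ℕ) : ℝ) = (N : ℝ) - 2 * m - 1 := by
          rw [Nat.cast_sub (by omega), Nat.cast_sub hm2]; push_cast; ring
        have hNk : ((N - 2 * m : ℕ) : ℝ) ≤ N := by exact_mod_cast Nat.sub_le N (2 * m)
        rw [abs_mul, abs_mul, abs_pow, Nat.abs_cast]
        calc |C m x| * ((((N - 2 * m : ℕ) : ℝ)) * |t| ^ (N - 2 * m - 1))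
            ≤ K₂ * y ^ (2 * (m : ℝ) - ℓ) * ((N : ℝ) * y ^ ((N - 2 * m - 1 : ℕ) : ℝ)) :=
              mul_le_mul (hCb m hm2 x hx) (mul_le_mul hNk (htk _) (pow_nonneg (abs_nonneg t) _)
                (Nat.cast_nonneg N)) (by positivity) (by positivity)
          _ = (N : ℝ) * K₂ * y ^ (a - 1) := by
              rw [hcast1, show K₂ * y ^ (2 * (m : ℝ) - ℓ) * ((N : ℝ) * y ^ ((N : ℝ) - 2 * m - 1))
                = (N : ℝ) * K₂ * (y ^ (2 * (m : ℝ) - ℓ) * y ^ ((N : ℝ) - 2 * m - 1)) by ring,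
                ← Real.rpow_add hy0, ha]
              ring_nf
    have hterm_x : ∀ m ∈ Finset.range (H + 1), |deriv (C m) x * t ^ (N - 2 * m)| ≤ K₂ * y ^ (a - 1) := by
      intro m hm
      have hm2 := hmem hm
      rw [abs_mul, abs_pow]
      calc |deriv (C m) x| * |t| ^ (N - 2 * m)
          ≤ K₂ * y ^ (2 * (m : ℝ) - ℓ - 1) * y ^ ((N - 2 * m : ℕ) : ℝ) :=
            mul_le_mul (hC'b m hm2 x hx) (htk _) (pow_nonneg (abs_nonneg t) _) (by positivity)
        _ = K₂ * y ^ (a - 1) := by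
            rw [mul_assoc, ← Real.rpow_add hy0, hcast hm2, ha]; ring_nf
    have hcard : ((Finset.range (H + 1)).card : ℝ) = ((N / 2 + 1 : ℕ) : ℝ) := by
      rw [Finset.card_range]
    -- derivatives of `p`
    have hpt : HasDerivAt (fun τ => p τ x)
        (∑ m ∈ Finset.range (H + 1), C m x * (((N - 2 * m : ℕ) : ℝ) * t ^ (N - 2 * m - 1))) t := by
      have : (fun τ => p τ x) = fun τ => ∑ m ∈ Finset.range (H + 1), C m x * τ ^ (N - 2 * m) :=
        funext fun τ => hp τ x
      rw [this]
      exact HasDerivAt.fun_sum fun m _ => (hasDerivAt_pow (N - 2 * m) t).const_mul _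
    have hpx : HasDerivAt (p t) (∑ m ∈ Finset.range (H + 1), deriv (C m) x * t ^ (N - 2 * m)) x := by
      have : p t = fun z => ∑ m ∈ Finset.range (H + 1), C m z * t ^ (N - 2 * m) :=
        funext fun z => hp t z
      rw [this]
      refine HasDerivAt.fun_sum fun m hm => ?_
      exact (((hCd m (hmem hm)) x hx).differentiableAt (Ioi_mem_nhds hx)).hasDerivAt.mul_const _
    refine ⟨?_, ?_, ?_⟩
    · rw [hp t x]
      calc |∑ m ∈ Finset.range (H + 1), C m x * t ^ (N - 2 * m)|
          ≤ ∑ m ∈ Finset.range (H + 1), |C m x * t ^ (N - 2 * m)| := Finset.abs_sum_le_sum_abs _ _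
        _ ≤ ∑ m ∈ Finset.range (H + 1), K₂ * y ^ a := Finset.sum_le_sum hterm
        _ = S * y ^ a := by rw [Finset.sum_const, nsmul_eq_mul, hcard, hS]; ring
    · rw [hpt.deriv]
      calc |∑ m ∈ Finset.range (H + 1), C m x * (((N - 2 * m : ℕ) : ℝ) * t ^ (N - 2 * m - 1))|
          ≤ ∑ m ∈ Finset.range (H + 1), |C m x * (((N - 2 * m : ℕ) : ℝ) * t ^ (N - 2 * m - 1))| :=
            Finset.abs_sum_le_sum_abs _ _
        _ ≤ ∑ m ∈ Finset.range (H + 1), (N : ℝ) * K₂ * y ^ (a - 1) := Finset.sum_le_sum hterm_t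
        _ = (N : ℝ) * S * y ^ (a - 1) := by rw [Finset.sum_const, nsmul_eq_mul, hcard, hS]; ring
    · rw [hpx.deriv]
      calc |∑ m ∈ Finset.range (H + 1), deriv (C m) x * t ^ (N - 2 * m)|
          ≤ ∑ m ∈ Finset.range (H + 1), |deriv (C m) x * t ^ (N - 2 * m)| := Finset.abs_sum_le_sum_abs _ _
        _ ≤ ∑ m ∈ Finset.range (H + 1), K₂ * y ^ (a - 1) := Finset.sum_le_sum hterm_x
        _ = S * y ^ (a - 1) := by rw [Finset.sum_const, nsmul_eq_mul, hcard, hS]; ring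
  -- (2) the energy density bound on channel regions
  set Ce : ℝ := S ^ 2 * ((N : ℝ) ^ 2 + 1 + B) with hCe
  have hden : ∀ R, x₀ + X ≤ R → ∀ t x, R + |t| < x →
      deriv (fun τ => p τ x) t ^ 2 + deriv (p t) x ^ 2 + V x * p t x ^ 2 ≤ Ce * (x - x₀) ^ (2 * a - 2) := by
    intro R hR t x hx
    have hx' : x₀ + X < x := by linarith [abs_nonneg t]
    have hty : |t| ≤ x - x₀ := by linarith [hX]
    set y : ℝ := x - x₀ with hy
    have hy0 : 0 < y := by rw [hy]; linarith [abs_nonneg t]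
    obtain ⟨h1, h2, h3⟩ := key t x hx' hty
    have hS0 : 0 ≤ S * y ^ a := le_trans (abs_nonneg _) h1
    -- squares
    have sq1 : deriv (fun τ => p τ x) t ^ 2 ≤ ((N : ℝ) * S * y ^ (a - 1)) ^ 2 := by
      rw [← sq_abs]; exact pow_le_pow_left₀ (abs_nonneg _) h2 2
    have sq2 : deriv (p t) x ^ 2 ≤ (S * y ^ (a - 1)) ^ 2 := by
      rw [← sq_abs]; exact pow_le_pow_left₀ (abs_nonneg _) h3 2
    have sq3 : p t x ^ 2 ≤ (S * y ^ a) ^ 2 := by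
      rw [← sq_abs]; exact pow_le_pow_left₀ (abs_nonneg _) h1 2
    have hV3 : V x * p t x ^ 2 ≤ B / y ^ 2 * (S * y ^ a) ^ 2 :=
      mul_le_mul (hVB x hx') sq3 (sq_nonneg _) (by positivity)
    -- exponent algebra
    have e1 : (y ^ (a - 1)) ^ 2 = y ^ (2 * a - 2) := by
      rw [← Real.rpow_natCast, ← Real.rpow_mul hy0.le]; norm_num; ring_nf
    have e2 : (y ^ a) ^ 2 / y ^ 2 = y ^ (2 * a - 2) := by
      rw [← Real.rpow_natCast (y ^ a), ← Real.rpow_mul hy0.le, show ((2 : ℕ) : ℝ) = 2 by norm_num,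
        show y ^ 2 = y ^ (2 : ℝ) by rw [← Real.rpow_natCast]; norm_num, ← Real.rpow_sub hy0]
      ring_nf
    calc deriv (fun τ => p τ x) t ^ 2 + deriv (p t) x ^ 2 + V x * p t x ^ 2
        ≤ ((N : ℝ) * S * y ^ (a - 1)) ^ 2 + (S * y ^ (a - 1)) ^ 2 + B / y ^ 2 * (S * y ^ a) ^ 2 :=
          add_le_add (add_le_add sq1 sq2) hV3
      _ = S ^ 2 * ((N : ℝ) ^ 2 + 1) * (y ^ (a - 1)) ^ 2 + B * S ^ 2 * ((y ^ a) ^ 2 / y ^ 2) := by ring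
      _ = Ce * y ^ (2 * a - 2) := by rw [e1, e2, hCe]; ring
  -- (3) the channel energy is dominated by an explicit decaying quantity
  have hq : 2 * a - 2 < -1 := by linarith
  have hCe0 : 0 ≤ Ce := by positivity
  have hbound : ∀ R, x₀ + X ≤ R → ∀ t,
      (∫⁻ x in Ioi (R + |t|), ENNReal.ofReal (deriv (fun τ => p τ x) t ^ 2 + deriv (p t) x ^ 2
          + V x * p t x ^ 2))
        ≤ ENNReal.ofReal (Ce * ((R + |t| - x₀) ^ (2 * a - 2 + 1) / (-(2 * a - 2) - 1))) := by
    intro R hR t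
    have hc : x₀ < R + |t| := by linarith [abs_nonneg t]
    obtain ⟨hint, hval⟩ := integral_Ioi_rpow_sub_const hq hc
    calc (∫⁻ x in Ioi (R + |t|), ENNReal.ofReal (deriv (fun τ => p τ x) t ^ 2 + deriv (p t) x ^ 2
            + V x * p t x ^ 2))
        ≤ ∫⁻ x in Ioi (R + |t|), ENNReal.ofReal (Ce * (x - x₀) ^ (2 * a - 2)) :=
          setLIntegral_mono' measurableSet_Ioi fun x hx => ENNReal.ofReal_le_ofReal (hden R hR t x hx)
      _ = ENNReal.ofReal (∫ x in Ioi (R + |t|), Ce * (x - x₀) ^ (2 * a - 2)) := by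
          rw [ofReal_integral_eq_lintegral_ofReal (hint.const_mul Ce)]
          refine (ae_restrict_iff' measurableSet_Ioi).2 (Eventually.of_forall fun x hx => ?_)
          have : x₀ < x := hc.trans hx
          exact mul_nonneg hCe0 (Real.rpow_pos_of_pos (by linarith) _).le
      _ = ENNReal.ofReal (Ce * ((R + |t| - x₀) ^ (2 * a - 2 + 1) / (-(2 * a - 2) - 1))) := by
          rw [integral_const_mul, hval]
  have hlim : ∀ R, x₀ + X ≤ R → ∀ {F : Filter ℝ}, Tendsto (fun t : ℝ => |t|) F atTop →
      Tendsto (fun t => ENNReal.ofReal (Ce * ((R + |t| - x₀) ^ (2 * a - 2 + 1) / (-(2 * a - 2) - 1))))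
        F (𝓝 0) := by
    intro R hR F hF
    have h1 : Tendsto (fun t : ℝ => R + |t| - x₀) F atTop :=
      tendsto_atTop_add_const_right _ _ (tendsto_atTop_add_const_left _ _ hF)
    have h2 : Tendsto (fun z : ℝ => z ^ (2 * a - 2 + 1)) atTop (𝓝 0) := by
      have := tendsto_rpow_neg_atTop (y := -(2 * a - 2 + 1)) (by linarith)
      simpa using this
    have h3 := ((h2.comp h1).div_const (-(2 * a - 2) - 1)).const_mul Ce
    simp only [zero_div, mul_zero] at h3
    simpa using (ENNReal.tendsto_ofReal h3)
  have htend : ∀ R, x₀ + X ≤ R → ∀ {F : Filter ℝ}, Tendsto (fun t : ℝ => |t|) F atTop →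
      Tendsto (fun t => ∫⁻ x in Ioi (R + |t|), ENNReal.ofReal (deriv (fun τ => p τ x) t ^ 2
        + deriv (p t) x ^ 2 + V x * p t x ^ 2)) F (𝓝 0) := fun R hR F hF =>
    tendsto_of_tendsto_of_tendsto_of_le_of_le tendsto_const_nhds (hlim R hR hF)
      (fun t => zero_le) (fun t => hbound R hR t)
  refine ⟨fun R hR t x hx => hden R hR t x hx, fun R hR => htend R hR tendsto_abs_atTop_atTop,
    fun R hR => htend R hR tendsto_abs_atBot_atTop, fun R hR t => ?_⟩
  exact lt_of_le_of_lt (hbound R hR t) ENNReal.ofReal_lt_top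

end Summit.FinalStateConjecture.FinalStateConjecture.Theorems
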